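import Summits.QuantumFields.BalabanUV.Beta.GAN24.ContactOneGaugeCell

/-!
# `GAN24.ContactOneGaugeCellTable` — CT-ROUTE step CT-3a, part 2c: the one-gauge contact cell in the TABLE-LEG-OUTER nesting (the order in which
# `Push3.push₃_inl_inl` ∕ `vertexW_apply` present it: right∕left table leg outside, index leg inside) — same identity, same bound

HONEST FRAMING (cell charter, verbatim): «discharging `BetaPertH` makes Bałaban's UV stability UNCONDITIONAL — a real constructive-QFT result;
it is NOT the continuum limit and NOT the Clay problem.»  DERIVED cell leaf (pub-balaban, G-an2-4 formalisation swarm → CRUX TEAM (2), seat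
`b2b-balaban-gan24-formalise-leaf-02`, gen 46; module CT-3a of the row owner's `CT3-MECHANISM.md` v1∕v1.1): [folklore] bookkeeping over parts 1∕1b∕2a∕2b BY NAME;
NO cited fact, NO `def`, NO `def … : Prop`, NO wall binder.  Discharges NO letter of (CONV-C); NEVER «G-an2-4 closed»; NOT hS0, NOT D1, NOT `BetaPertH`,
NOT continuum, NOT Clay.  «not in print; our bookkeeping».
HONEST DEPENDENCY (cell records, verbatim): «continuum YM on T⁴ ⇐ BetaPertH ∧ nine spine estimates (0/9 proved); BetaPertH ⇐ (D1) ∧ (D4) ∧ CAP+tail;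
G-an2-4 gates asym, D1 and NE2/3/4.»
ABSOLUTE RULE (cell charter, verbatim): «No internally-minted statement may enter as a cited fact. Every hypothesis is either kernel-proved in this
package or a verbatim quotation of a PUBLISHED theorem with page reference. The manuscript(s) under audit are NOT citable for their own disputed steps —
they are the thing under adjudication; programme-internal (2001/route/tribunal) claims are never citable.»

WHY THIS NESTING.  In `Push3.push₃_inl_inl` the entry is `Σ'_z Σ_{κ₂} (Σ'_x Σ_{κ₁} l·(vertexW w S) x z κ₁ κ₂)·r`, `vertexW w S … x z = Σ_κ Σ'_u w κ u·S κ u x z`: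
a pure-gauge LEFT (or RIGHT) table leg meets part 1's `tsum_dz_mul_wilsonA` (`tsum_wilsonA_mul_dz`) INSIDE the index-leg sum, so the cell arrives as
`Σ'_z Σ_β T₃ β z·(Σ'_u Σ_{κ′} T₁ κ′ u·bracket)` — the other TABLE leg outside, the INDEX leg inside; part 2b's `cell_eq` has the index leg outside.
## What is proved (generic `d`; `e_κ := B6BondElimination.unitVec κ`; `d*d := curvAdj ∘ curv`)
* `inner'_eq` (no hypothesis): `Σ'_u Σ_{κ′} T₁ κ′ u·(½(ψ(u+e_{κ′}) − ½(ψ z + ψ(z+e_β)))·(d*dδ_{(κ′,u)})_β z)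
  = ½·Σ_{v∈cube 2} Σ_{κ′} (d*dδ_{(β,0)})_{κ′} v·(ψ(z+v+e_{κ′})·T₁ κ′ (z+v)) − ½·½(ψ z + ψ(z+e_β))·(d*dT₁)_β z`.
* **`cell_eq'`** (sup hypotheses: `T₃` summable, `ψ`, `T₁`, `d*dT₁` bounded): the table-leg-outer cell equals the SAME `½·Σ' ψ_tip·T₁·d*dT₃ − ½·Σ' ψ_mid·T₃·d*dT₁`
  as part 2b's `cell_eq`; hence `cell_eq'_eq_cell` (the two nestings agree under both sets of hypotheses) and **`abs_cell_le'`** (the same bound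
  `½(d+1)·E_ψ e^{κ₀}·(E₁M₃ + E₃M₁)·L^{d+1}·Zl(κ₀/(4(d+1)))·e^{−(κ₀/12)(‖z₁−z₀‖∞+‖z₃−z₀‖∞)}` under the envelope hypotheses of `abs_cell_le`).
* **`cellIdx_eq'`** ∕ **`abs_cellIdx_le'`**: the index-slot cell in the orientation `push₃` delivers it (`Σ'_z Σ_b R b z·Σ'_x Σ_a L a x·(½(ψ z − ψ x)·(d*dδ_{(b,z)})_a x)`,
  the RIGHT leg outside) — by the matrix symmetry it is MINUS part 2b's `cellIdx` with the legs exchanged; same bound with `(E_L·M_R + E_R·M_L)`.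
Provenance: seat b2b-balaban-gan24-formalise-leaf-02 gen 46 (prover-…-leaf-02-g46-0), 2026-08-21; over parts 1–2b BY NAME.
-/

namespace Summit.QuantumFields.BalabanUV.Beta.GAN24.ContactOneGaugeCellTable

open Finset
open scoped BigOperators
open Literature.MathematicalPhysics.QuantumFieldTheory.LatticeForm (quo)
open Literature.MathematicalPhysics.QuantumFieldTheory.Balaban1983to89
open Literature.MathematicalPhysics.QuantumFieldTheory.Balaban1983to89.Beta
open B4ContourShift (supNorm supNorm_nonneg)
open ExpKernelCalculus (Zl)
open AffineAveraging (Form1 curv curvAdj)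
open B6BondElimination (unitVec unitVec_apply)
open KKTFluctuationKernel (delta1 delta1_apply)
open Summit.QuantumFields.BalabanUV.Beta.AxialDressingRooted (cube mem_cube)
open Summit.QuantumFields.BalabanUV.Beta.BorderedHessian (curvAdj_curv_delta1_symm)
open Summit.QuantumFields.BalabanUV.Beta.GAN24.ContactOneGaugeCellMaxwell (tsum_mul_curvAdj_curv_delta1 tsum_mul_curvAdj_curv_delta1_eq_window
  summable_mul_curvAdj_curv_delta1)
open Summit.QuantumFields.BalabanUV.Beta.GAN24.ContactOneGaugeCellBound (abs_le_of_env summable_of_env)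
open Summit.QuantumFields.BalabanUV.Beta.GAN24.ContactOneGaugeCell (summable_mul_window sum_mul_window_eq tsum_mul_window_eq_tsum_mul_curvAdj_curv
  cell_eq abs_cell_le cellIdx_eq abs_cellIdx_le)

noncomputable section

variable {d : ℕ} {ψ : (Fin (d + 1) → ℤ) → ℝ} {T₁ T₃ : Form1 (d + 1) ℝ}

/-- [folklore] **THE INNER (INDEX-LEG) SUM IS FINITE AND SPLITS** (matrix symmetry `(d*dδ_{(κ′,u)})_β z = (d*dδ_{(β,z)})_{κ′} u`, then part 1b's contraction
and window form with the roles of the two legs exchanged): no hypothesis. -/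
theorem inner'_eq (ψ : (Fin (d + 1) → ℤ) → ℝ) (T₁ : Form1 (d + 1) ℝ) (β : Fin (d + 1)) (z : Fin (d + 1) → ℤ) :
    ∑' u, ∑ κ', T₁ κ' u * ((1 / 2 : ℝ) * (ψ (u + unitVec κ') - (ψ z + ψ (z + unitVec β)) / 2) * curvAdj (curv (delta1 κ' u)) β z) =
      (1 / 2 : ℝ) * ∑ v ∈ cube (d + 1) 2, ∑ κ', curvAdj (curv (delta1 β 0)) κ' v * (ψ (z + v + unitVec κ') * T₁ κ' (z + v)) -
        (1 / 2 : ℝ) * ((ψ z + ψ (z + unitVec β)) / 2) * curvAdj (curv T₁) β z := by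
  have hsplit : ∀ u, (∑ κ', T₁ κ' u * ((1 / 2 : ℝ) * (ψ (u + unitVec κ') - (ψ z + ψ (z + unitVec β)) / 2) * curvAdj (curv (delta1 κ' u)) β z)) =
      (1 / 2 : ℝ) * (∑ κ', ψ (u + unitVec κ') * T₁ κ' u * curvAdj (curv (delta1 β z)) κ' u) -
        (1 / 2 : ℝ) * ((ψ z + ψ (z + unitVec β)) / 2) * (∑ κ', T₁ κ' u * curvAdj (curv (delta1 β z)) κ' u) := by
    intro u
    rw [Finset.mul_sum, Finset.mul_sum, ← Finset.sum_sub_distrib]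
    refine Finset.sum_congr rfl fun κ' _ => ?_
    rw [curvAdj_curv_delta1_symm β κ' z u]
    ring
  have hs1 : Summable fun u => ∑ κ', ψ (u + unitVec κ') * T₁ κ' u * curvAdj (curv (delta1 β z)) κ' u :=
    summable_mul_curvAdj_curv_delta1 (fun κ' u => ψ (u + unitVec κ') * T₁ κ' u) β z
  have hs2 : Summable fun u => ∑ κ', T₁ κ' u * curvAdj (curv (delta1 β z)) κ' u := summable_mul_curvAdj_curv_delta1 T₁ β z
  rw [tsum_congr hsplit, (hs1.mul_left _).tsum_sub (hs2.mul_left _), tsum_mul_left, tsum_mul_left,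
    tsum_mul_curvAdj_curv_delta1_eq_window (fun κ' u => ψ (u + unitVec κ') * T₁ κ' u) β z, tsum_mul_curvAdj_curv_delta1 T₁ β z]

/-- [folklore] **THE CELL IDENTITY, TABLE-LEG-OUTER NESTING** (sup hypotheses only: `T₃` summable, `ψ`, `T₁`, `d*dT₁` bounded):
`Σ'_z Σ_β T₃ β z·Σ'_u Σ_{κ′} T₁ κ′ u·(½(ψ(u+e_{κ′}) − ½(ψ z + ψ(z+e_β)))·(d*dδ_{(κ′,u)})_β z)
  = ½·Σ'_u Σ_{κ′} ψ(u+e_{κ′})·T₁ κ′ u·(d*dT₃)_{κ′} u − ½·Σ'_z Σ_β ½(ψ z + ψ(z+e_β))·T₃ β z·(d*dT₁)_β z` — the tip part by part 2b's swap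
(summable table leg × the bounded weighted index leg `ψ_tip·T₁`), the midpoint part directly. -/
theorem cell_eq' (hT₃ : ∀ β, Summable (T₃ β)) {Bψ B₁ BM : ℝ} (hψ : ∀ x, |ψ x| ≤ Bψ) (hT₁ : ∀ κ u, |T₁ κ u| ≤ B₁)
    (hM₁ : ∀ β z, |curvAdj (curv T₁) β z| ≤ BM) :
    ∑' z, ∑ β, T₃ β z *
        ∑' u, ∑ κ', T₁ κ' u * ((1 / 2 : ℝ) * (ψ (u + unitVec κ') - (ψ z + ψ (z + unitVec β)) / 2) * curvAdj (curv (delta1 κ' u)) β z) =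
      (1 / 2 : ℝ) * ∑' u, ∑ κ', ψ (u + unitVec κ') * T₁ κ' u * curvAdj (curv T₃) κ' u -
        (1 / 2 : ℝ) * ∑' z, ∑ β, (ψ z + ψ (z + unitVec β)) / 2 * T₃ β z * curvAdj (curv T₁) β z := by
  have hBψ : 0 ≤ Bψ := (abs_nonneg _).trans (hψ 0)
  set m : Form1 (d + 1) ℝ := fun κ' u => ψ (u + unitVec κ') * T₁ κ' u with hm
  have hmB : ∀ κ' u, |m κ' u| ≤ Bψ * B₁ := by
    intro κ' u
    rw [hm]; dsimp only
    rw [abs_mul]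
    exact mul_le_mul (hψ _) (hT₁ κ' u) (abs_nonneg _) hBψ
  have houter : ∀ z, (∑ β, T₃ β z *
      ∑' u, ∑ κ', T₁ κ' u * ((1 / 2 : ℝ) * (ψ (u + unitVec κ') - (ψ z + ψ (z + unitVec β)) / 2) * curvAdj (curv (delta1 κ' u)) β z)) =
      (1 / 2 : ℝ) * (∑ β, T₃ β z * (∑ v ∈ cube (d + 1) 2, ∑ κ', curvAdj (curv (delta1 β 0)) κ' v * m κ' (z + v))) -
        (1 / 2 : ℝ) * (∑ β, (ψ z + ψ (z + unitVec β)) / 2 * T₃ β z * curvAdj (curv T₁) β z) := by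
    intro z
    rw [Finset.mul_sum, Finset.mul_sum, ← Finset.sum_sub_distrib]
    refine Finset.sum_congr rfl fun β _ => ?_
    rw [inner'_eq ψ T₁ β z]
    simp only [hm, add_right_comm _ _ (unitVec _)]
    ring
  have hsA : Summable fun z => ∑ β, T₃ β z * (∑ v ∈ cube (d + 1) 2, ∑ κ', curvAdj (curv (delta1 β 0)) κ' v * m κ' (z + v)) :=
    (summable_sum (s := cube (d + 1) 2) fun v (_ : v ∈ cube (d + 1) 2) => summable_mul_window hT₃ hmB v).congr
      fun z => (sum_mul_window_eq T₃ m z).symm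
  have hsB : Summable fun z => ∑ β, (ψ z + ψ (z + unitVec β)) / 2 * T₃ β z * curvAdj (curv T₁) β z := by
    refine summable_sum fun β _ => Summable.of_norm_bounded ((((hT₃ β).abs).mul_left Bψ).mul_right BM) (fun z => ?_)
    rw [Real.norm_eq_abs, abs_mul, abs_mul, abs_div, abs_two]
    have h1 := hψ z; have h2 := hψ (z + unitVec β); have h3 := hM₁ β z
    have h4 := abs_add_le (ψ z) (ψ (z + unitVec β))
    have h5 : |ψ z + ψ (z + unitVec β)| / 2 ≤ Bψ := by linarith
    have h0 : 0 ≤ |T₃ β z| := abs_nonneg _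
    have h6 : 0 ≤ |ψ z + ψ (z + unitVec β)| / 2 := by positivity
    calc |ψ z + ψ (z + unitVec β)| / 2 * |T₃ β z| * |curvAdj (curv T₁) β z| ≤ Bψ * |T₃ β z| * BM := by gcongr
      _ = _ := by ring
  rw [tsum_congr houter, (hsA.mul_left _).tsum_sub (hsB.mul_left _), tsum_mul_left, tsum_mul_left,
    tsum_mul_window_eq_tsum_mul_curvAdj_curv hT₃ hmB]

/-- [folklore] **THE ONE-GAUGE CELL BOUND, TABLE-LEG-OUTER NESTING** — same letters, same bound as part 2b's `abs_cell_le`: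
`|cell'| ≤ ½(d+1)·E_ψ·e^{κ₀}·(E₁·M₃ + E₃·M₁)·L^{d+1}·Zl(κ₀/(4(d+1)))·e^{−(κ₀/12)(‖z₁−z₀‖∞ + ‖z₃−z₀‖∞)}`. -/
theorem abs_cell_le' {L : ℕ} (hL : 1 ≤ L) {κ₀ : ℝ} (hκ : 0 < κ₀) {z₀ z₁ z₃ : Fin (d + 1) → ℤ} {Eψ E₁ E₃ M₁ M₃ : ℝ}
    (hEψ : 0 ≤ Eψ) (hE₁ : 0 ≤ E₁) (hE₃ : 0 ≤ E₃) (hM₁0 : 0 ≤ M₁) (hM₃0 : 0 ≤ M₃)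
    (hψ : ∀ x, |ψ x| ≤ Eψ * Real.exp (-(κ₀ * supNorm (quo L x - z₀))))
    (hT₁ : ∀ κ u, |T₁ κ u| ≤ E₁ * Real.exp (-(κ₀ * supNorm (quo L u - z₁))))
    (hM₁ : ∀ κ u, |curvAdj (curv T₁) κ u| ≤ M₁ * Real.exp (-(κ₀ * supNorm (quo L u - z₁))))
    (hT₃ : ∀ κ u, |T₃ κ u| ≤ E₃ * Real.exp (-(κ₀ * supNorm (quo L u - z₃))))
    (hM₃ : ∀ κ u, |curvAdj (curv T₃) κ u| ≤ M₃ * Real.exp (-(κ₀ * supNorm (quo L u - z₃)))) :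
    |∑' z, ∑ β, T₃ β z *
        ∑' u, ∑ κ', T₁ κ' u * ((1 / 2 : ℝ) * (ψ (u + unitVec κ') - (ψ z + ψ (z + unitVec β)) / 2) * curvAdj (curv (delta1 κ' u)) β z)| ≤
      (1 / 2 : ℝ) * (((d : ℝ) + 1) * (Eψ * Real.exp κ₀) * (E₁ * M₃ + E₃ * M₁)) *
        ((L : ℝ) ^ (d + 1) * Zl (d + 1) (κ₀ / (4 * ((d : ℝ) + 1))) * Real.exp (-(κ₀ / 12) * (supNorm (z₁ - z₀) + supNorm (z₃ - z₀)))) := by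
  rw [cell_eq' (ψ := ψ) (T₁ := T₁) (T₃ := T₃) (fun β => summable_of_env hL hκ (hT₃ β)) (abs_le_of_env hκ.le hEψ hψ)
      (fun κ u => abs_le_of_env hκ.le hE₁ (hT₁ κ) u) (fun β z => abs_le_of_env hκ.le hM₁0 (hM₁ β) z),
    ← cell_eq (ψ := ψ) (T₁ := T₁) (T₃ := T₃) (fun κ => summable_of_env hL hκ (hT₁ κ)) (abs_le_of_env hκ.le hEψ hψ)
      (fun β z => abs_le_of_env hκ.le hE₃ (hT₃ β) z) (fun κ u => abs_le_of_env hκ.le hM₃0 (hM₃ κ) u)]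
  exact abs_cell_le hL hκ hEψ hE₁ hE₃ hM₁0 hM₃0 hψ hT₁ hM₁ hT₃ hM₃

/-- [folklore] **THE INDEX-SLOT CELL IN `push₃`'S ORIENTATION** (RIGHT leg outside, LEFT leg inside; bracket `½(ψ z − ψ x)·(d*dδ_{(b,z)})_a x` from part 1's
`tsum_dz_mul_wilsonA_idx`): it is MINUS part 2b's `cellIdx` with the legs exchanged (matrix symmetry + antisymmetry of the site weight), hence
`= ½·Σ'_z Σ_b ψ z·R b z·(d*dL)_b z − ½·Σ'_x Σ_a ψ x·L a x·(d*dR)_a x` again (sup hypotheses: `R` summable, `ψ`, `L`, `d*dL` bounded). -/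
theorem cellIdx_eq' {TL TR : Form1 (d + 1) ℝ} (hTR : ∀ b, Summable (TR b)) {Bψ BL BM : ℝ} (hψ : ∀ x, |ψ x| ≤ Bψ)
    (hTL : ∀ a x, |TL a x| ≤ BL) (hML : ∀ b z, |curvAdj (curv TL) b z| ≤ BM) :
    ∑' z, ∑ b, TR b z * ∑' x, ∑ a, TL a x * ((1 / 2 : ℝ) * (ψ z - ψ x) * curvAdj (curv (delta1 b z)) a x) =
      (1 / 2 : ℝ) * ∑' z, ∑ b, ψ z * TR b z * curvAdj (curv TL) b z -
        (1 / 2 : ℝ) * ∑' x, ∑ a, ψ x * TL a x * curvAdj (curv TR) a x := by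
  have hflip : ∀ z b, (∑' x, ∑ a, TL a x * ((1 / 2 : ℝ) * (ψ z - ψ x) * curvAdj (curv (delta1 b z)) a x)) =
      -∑' x, ∑ a, TL a x * ((1 / 2 : ℝ) * (ψ x - ψ z) * curvAdj (curv (delta1 a x)) b z) := by
    intro z b
    rw [← tsum_neg]
    refine tsum_congr fun x => ?_
    rw [← Finset.sum_neg_distrib]
    refine Finset.sum_congr rfl fun a _ => ?_
    rw [curvAdj_curv_delta1_symm a b x z]
    ring
  have h1 : (∑' z, ∑ b, TR b z * ∑' x, ∑ a, TL a x * ((1 / 2 : ℝ) * (ψ z - ψ x) * curvAdj (curv (delta1 b z)) a x)) =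
      -∑' z, ∑ b, TR b z * ∑' x, ∑ a, TL a x * ((1 / 2 : ℝ) * (ψ x - ψ z) * curvAdj (curv (delta1 a x)) b z) := by
    rw [← tsum_neg]
    refine tsum_congr fun z => ?_
    rw [← Finset.sum_neg_distrib]
    refine Finset.sum_congr rfl fun b _ => ?_
    rw [hflip z b, mul_neg]
  rw [h1, cellIdx_eq (ψ := ψ) (TL := TR) (TR := TL) hTR hψ hTL hML]
  ring

/-- [folklore] **THE INDEX-SLOT CELL BOUND IN `push₃`'S ORIENTATION** — same letters: `≤ ½(d+1)·E_ψ·e^{κ₀}·(E_R·M_L + E_L·M_R)·L^{d+1}·Zl·e^{−(κ₀/12)(‖z_L−z₀‖∞+‖z_R−z₀‖∞)}`. -/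
theorem abs_cellIdx_le' {TL TR : Form1 (d + 1) ℝ} {L : ℕ} (hL : 1 ≤ L) {κ₀ : ℝ} (hκ : 0 < κ₀) {z₀ zL zR : Fin (d + 1) → ℤ}
    {Eψ EL ER ML MR : ℝ} (hEψ : 0 ≤ Eψ) (hEL : 0 ≤ EL) (hER : 0 ≤ ER) (hML0 : 0 ≤ ML) (hMR0 : 0 ≤ MR)
    (hψ : ∀ x, |ψ x| ≤ Eψ * Real.exp (-(κ₀ * supNorm (quo L x - z₀))))
    (hTL : ∀ a x, |TL a x| ≤ EL * Real.exp (-(κ₀ * supNorm (quo L x - zL))))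
    (hML : ∀ a x, |curvAdj (curv TL) a x| ≤ ML * Real.exp (-(κ₀ * supNorm (quo L x - zL))))
    (hTR : ∀ b z, |TR b z| ≤ ER * Real.exp (-(κ₀ * supNorm (quo L z - zR))))
    (hMR : ∀ b z, |curvAdj (curv TR) b z| ≤ MR * Real.exp (-(κ₀ * supNorm (quo L z - zR)))) :
    |∑' z, ∑ b, TR b z * ∑' x, ∑ a, TL a x * ((1 / 2 : ℝ) * (ψ z - ψ x) * curvAdj (curv (delta1 b z)) a x)| ≤
      (1 / 2 : ℝ) * (((d : ℝ) + 1) * (Eψ * Real.exp κ₀) * (ER * ML + EL * MR)) *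
        ((L : ℝ) ^ (d + 1) * Zl (d + 1) (κ₀ / (4 * ((d : ℝ) + 1))) * Real.exp (-(κ₀ / 12) * (supNorm (zL - z₀) + supNorm (zR - z₀)))) := by
  rw [cellIdx_eq' (ψ := ψ) (TL := TL) (TR := TR) (fun b => summable_of_env hL hκ (hTR b)) (abs_le_of_env hκ.le hEψ hψ)
      (fun a x => abs_le_of_env hκ.le hEL (hTL a) x) (fun b z => abs_le_of_env hκ.le hML0 (hML b) z),
    ← cellIdx_eq (ψ := ψ) (TL := TL) (TR := TR) (fun a => summable_of_env hL hκ (hTL a)) (abs_le_of_env hκ.le hEψ hψ)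
      (fun b z => abs_le_of_env hκ.le hER (hTR b) z) (fun a x => abs_le_of_env hκ.le hMR0 (hMR a) x)]
  exact abs_cellIdx_le hL hκ hEψ hEL hER hML0 hMR0 hψ hTL hML hTR hMR

end

end Summit.QuantumFields.BalabanUV.Beta.GAN24.ContactOneGaugeCellTable
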